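import Summits.QuantumFields.BalabanUV.T4Continuum.Support.RegionBoxCollarLift
import Summits.QuantumFields.BalabanUV.T4Continuum.Support.RegionGaugeHoled

/-!
# `BalabanUV.T4Continuum.Support.RegionGaugeBoxHole` — NE2 (node U1a) formalisation swarm, SUPPLIER item «Δ1-VEC-W1-HOLED» v3 under the
# owner's sub-row `T4-U1a.S-NE2-D1-DIRICHLET°` (vector layer W1): **W1 WITH ONE LEVEL-UNIFORM CONSTANT ON THE COMPLEMENT OF A BOX OF BLOCKS**
# `S = T ∖ K`, `K = Π_ν [lo_ν, lo_ν + len_ν)` — an exterior component of MANY blocks (thick obstacle; re-entrant along all its edges and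
# corners) «not in print; our construction» (unit b2b-balaban-t4-ne2-formalise-leaf-09, gen 9, v1)

HONEST FRAMING (T4-DAG p. 1).  [folklore] `U = 1`, the faithful single-scale star-bond operator, ONE region `S = T ∖ K` (`1 ≤ len_ν`,
`len_ν + 2 ≤ M_ν`), finite torus.  The argument of `RegionGaugeHoled` with the coordinatewise fold of the box collar into the box
(`RegionBoxCollar{Fold,Cutoff,Lift}`): the torus gauge `μ̃` has ALL block means zero, so the blockwise Poincaré inequality on EACH block of
`K` pays the mass — no Poincaré inequality on the (large) component is needed; every image bond of the fold is a `K`-internal bond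
(in-block, or between adjacent blocks of `K`), on which `ext A = 0`.  SAME constant `holedConst d a a′` as for one hole.  Nothing printed
is a hypothesis; NE2 (U1a) NOT proved; spine PROVED 0/9 unchanged; NOT [B9] (3.16)∕(3.23)–(3.27) as printed; several boxes ∕ general exterior
components NOT treated here; NOT infinite volume, NOT the mass gap, NOT Clay.  HONEST DEPENDENCY (verbatim): «continuum YM on T⁴ ⇐ BetaPertH
∧ nine spine estimates (0/9 proved); BetaPertH ⇐ (D1) ∧ (D4) ∧ CAP+tail; G-an2-4 gates asym, D1 and NE2/3/4.»

ABSOLUTE RULE (cell, verbatim): «No internally-minted statement may enter as a cited fact. Every hypothesis is either kernel-proved in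
this package or a verbatim quotation of a PUBLISHED theorem with page reference. The manuscript(s) under audit are NOT citable for
their own disputed steps — they are the thing under adjudication; programme-internal (2001/route/tribunal) claims are never citable.»
[folklore] throughout; one data def `boxBlocks` (the `Finset` of the box's blocks); no `def … : Prop`.  NOT CLAIMED: several boxes; general components; W3̃; NE2; NE3.
-/

noncomputable section

open scoped BigOperators ComplexConjugate Matrix Matrix.Norms.L2Operator
open Finset

namespace Summit.QuantumFields.BalabanUV.T4Continuum.RegionGaugeBoxHole

open Literature.MathematicalPhysics.QuantumFieldTheory.Balaban1983to89.B5Prop11Plancherel (Tor fine unitVec)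
open Literature.MathematicalPhysics.QuantumFieldTheory.Balaban1983to89.B5Prop11Lower (nsq nsq_nonneg)
open Literature.MathematicalPhysics.QuantumFieldTheory.Balaban1983to89.B5Action121 (GradOp GradOp_mulVec sdiff sdiff_mulVec)
open Literature.MathematicalPhysics.QuantumFieldTheory.Balaban1983to89.B5Block118 (bpt QsOp)
open Literature.MathematicalPhysics.QuantumFieldTheory.Balaban1983to89.B5Blocks16 (blockOf blockOf_bpt)
open Literature.MathematicalPhysics.QuantumFieldTheory.Balaban1983to89.B5G183RateUnitTower (lev)
open Summit.QuantumFields.BalabanUV.T4Continuum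
open Summit.QuantumFields.BalabanUV.T4Continuum.SubtypeCompression (Coercive ext ext_apply_of ext_apply_of_not nsq_ext)
open Summit.QuantumFields.BalabanUV.T4Continuum.ScalarAveragedPropagator (gammaPs)
open Summit.QuantumFields.BalabanUV.T4Continuum.ScalarAveragedCompression (sigma0 sigma0_pos)
open Summit.QuantumFields.BalabanUV.T4Continuum.ScalarBlockTrialFunction (digits)
open Summit.QuantumFields.BalabanUV.T4Continuum.ScalarBlockPoincareLocal (sum_block_norm_sub_mean_sq_le)
open Summit.QuantumFields.BalabanUV.T4Continuum.RegionGaugeFixedVectorFlat (bpt_blockOf_digits)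
open Summit.QuantumFields.BalabanUV.T4Continuum.RegionScalarCompression (QOm GOm)
open Summit.QuantumFields.BalabanUV.T4Continuum.RegionGaugeFixedVector (starReg curlR gradR avgR regionDeltaA)
open Summit.QuantumFields.BalabanUV.T4Continuum.RegionGaugeSlice (SliceCoercive)
open Summit.QuantumFields.BalabanUV.T4Continuum.RegionGaugeSliceOrth (OrthSliceCoercive)
open Summit.QuantumFields.BalabanUV.T4Continuum.RegionGaugeSliceOrthRegion (sliceCoercive_region_of_orthSlice
  coercive_regionDeltaA_of_orthSlice opNorm_inv_regionDeltaA_le_of_orthSlice)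
open Summit.QuantumFields.BalabanUV.T4Continuum.RegionGaugeOrbit (orbitConst orbitConst_pos orthSlice_of_gaugePoincare)
open Summit.QuantumFields.BalabanUV.T4Continuum.RegionStarLineGaugeTower (orthSlice_one orbitConst_le)
open Summit.QuantumFields.BalabanUV.T4Continuum.DirichletRegionTower (gamD gamD_pos)
open Summit.QuantumFields.BalabanUV.T4Continuum.RegionCollarFold (koff)
open Summit.QuantumFields.BalabanUV.T4Continuum.RegionBoxCollarFold
open Summit.QuantumFields.BalabanUV.T4Continuum.RegionBoxCollarCutoff
open Summit.QuantumFields.BalabanUV.T4Continuum.RegionBoxCollarLift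
open Summit.QuantumFields.BalabanUV.T4Continuum.RegionGaugeHoled (exists_torus_gauge Kholed holedConst KC₂_nonneg)
open Summit.QuantumFields.BalabanUV.Beta.GAN24.DirichletBoxCompression (toBlock_mulVec')
open Summit.QuantumFields.BalabanUV.Beta.GAN24.DirichletBoxTrace (blockReg)

variable {d : ℕ} (n : ℕ) [NeZero n] (M : Fin d → ℕ) [hM : ∀ μ, NeZero (M μ)] (lo : Tor M) (len : Fin d → ℕ) (a a' : ℝ)

/-- **THE BLOCKS OF THE BOX** `K = Π_ν [lo_ν, lo_ν + len_ν)` as a finite set (the images of the inside indices). [folklore] -/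
def boxBlocks : Finset (Tor M) := (KIn len).image (cblkB M lo)


/-! ## §1 The box-internal data of the torus gauge are residual energy (any region off the box) -/

/-- **A SITE'S BLOCK IS IN THE BOX IFF ALL ITS OFFSETS ARE INSIDE** (`len_ν + 2 ≤ M_ν`). [folklore] -/
theorem mem_boxBlocks_iff (hM2 : ∀ μ, len μ + 2 ≤ M μ) (x : Tor (fine n M)) :
    blockOf n M x ∈ boxBlocks M lo len ↔ ∀ ν, 1 ≤ koff n M lo x ν ∧ koff n M lo x ν ≤ len ν := by
  classical
  rw [boxBlocks, Finset.mem_image]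
  constructor
  · rintro ⟨i, hi, hix⟩
    have hin := (mem_KIn len).1 hi
    have hiM := lt_M_of_mem_KOff M len hM2 (KIn_subset_KOff len hi)
    have hk : koff n M lo x = i := by
      have h := koffB_csiteB n M lo i hiM (digits n M x)
      have hx : csiteB n M lo i (digits n M x) = x := by
        rw [csiteB, hix, bpt_blockOf_digits]
      rw [hx] at h
      exact h
    intro ν; rw [hk]; exact hin ν
  · intro h
    exact ⟨koff n M lo x, (mem_KIn len).2 h, (blockOf_eq_cblkB n M lo x).symm⟩

/-- a site lies outside `Ω(T ∖ K)` iff all its offsets are inside (`len_ν + 2 ≤ M_ν`). [folklore] -/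
theorem not_blockReg_iff (hM2 : ∀ μ, len μ + 2 ≤ M μ) (x : Tor (fine n M)) :
    ¬ blockReg n M (fun y : Tor M => y ∉ boxBlocks M lo len) x ↔ ∀ ν, 1 ≤ koff n M lo x ν ∧ koff n M lo x ν ≤ len ν := by
  have hb : blockReg n M (fun y : Tor M => y ∉ boxBlocks M lo len) x ↔ blockOf n M x ∉ boxBlocks M lo len := Iff.rfl
  rw [hb, not_not, mem_boxBlocks_iff n M lo len hM2]

section AnyRegion

variable (S : Tor M → Prop) [DecidablePred S]

omit hM [DecidablePred S] in
/-- the blocks of the box in the chart are blocks of the box. [folklore] -/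
theorem cblkB_mem_boxBlocks {i : Fin d → ℕ} (hi : i ∈ KIn len) : cblkB M lo i ∈ boxBlocks M lo len :=
  Finset.mem_image.2 ⟨i, hi, rfl⟩

omit [DecidablePred S] in
/-- **A BOX-INTERNAL BOND IS NOT A STAR BOND of any region whose blocks avoid the box**. [folklore] -/
theorem not_starReg_internal (hKS : ∀ y ∈ boxBlocks M lo len, ¬ S y) {i : Fin d → ℕ} (hi : i ∈ KIn len)
    (j : Fin d → Fin n) (ρ : Fin d) (h : (j ρ : ℕ) + 1 < n ∨ i ρ + 1 ≤ len ρ) : ¬ starReg n M S (csiteB n M lo i j, ρ) := by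
  have hin : ∀ ν, 1 ≤ i ν ∧ i ν ≤ len ν := (mem_KIn len).1 hi
  have h1 : ¬ blockReg n M S (csiteB n M lo i j) := by
    show ¬ S (blockOf n M (csiteB n M lo i j))
    rw [csiteB, blockOf_bpt]
    exact hKS _ (cblkB_mem_boxBlocks M lo len hi)
  have h2 : ¬ blockReg n M S (csiteB n M lo i j + unitVec (fine n M) ρ) := by
    show ¬ S (blockOf n M (csiteB n M lo i j + unitVec (fine n M) ρ))
    by_cases hlt : (j ρ : ℕ) + 1 < n
    · rw [csiteB_add_unitVec_of_lt n M lo i j ρ hlt, csiteB, blockOf_bpt]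
      exact hKS _ (cblkB_mem_boxBlocks M lo len hi)
    · have heq : (j ρ : ℕ) + 1 = n := by have := (j ρ).isLt; omega
      have hρ : i ρ + 1 ≤ len ρ := h.resolve_left hlt
      have hi' : Function.update i ρ (i ρ + 1) ∈ KIn len := (mem_KIn len).2 fun ν => by
        by_cases hν : ν = ρ
        · subst hν; simp only [Function.update_self]; constructor <;> omega
        · rw [Function.update_of_ne hν]; exact hin ν
      rw [csiteB_add_unitVec_of_eq n M lo i j ρ heq, csiteB, blockOf_bpt]
      exact hKS _ (cblkB_mem_boxBlocks M lo len hi')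
  rintro (h | h)
  · exact h1 h
  · exact h2 h

/-- the sites of the box. [folklore] -/
def boxSites : Finset (Tor (fine n M)) := (KIn len ×ˢ (univ : Finset (Fin d → Fin n))).image fun ij => csiteB n M lo ij.1 ij.2

/-- **THE BOX-INTERNAL GRADIENT OF `μ̃` IS CARRIED BY THE RESIDUAL ON THE BOX'S SITES**: for any region whose blocks avoid the box,
`Σ_{i ∈ KIn} Σ_ρ GK_{i,ρ} μ̃ ≤ Σ_ρ Σ_{x ∈ boxSites} ‖(ext A − ∂μ̃)(x, ρ)‖²`. [folklore] -/
theorem sum_GK_le_boxSum (hKS : ∀ y ∈ boxBlocks M lo len, ¬ S y) (hM2 : ∀ μ, len μ + 2 ≤ M μ) (A : {b // starReg n M S b} → ℂ)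
    (μt : Tor (fine n M) → ℂ) :
    ∑ i ∈ KIn len, ∑ ρ, GK n M lo len μt i ρ
      ≤ ∑ ρ : Fin d, ∑ x ∈ boxSites n M lo len, ‖ext (starReg n M S) A (x, ρ) - (GradOp (fine n M) (n : ℂ) *ᵥ μt) (x, ρ)‖ ^ 2 := by
  classical
  set R : Tor (fine n M) × Fin d → ℂ := fun b => ext (starReg n M S) A b - (GradOp (fine n M) (n : ℂ) *ᵥ μt) b with hR
  have hterm : ∀ i ∈ KIn len, ∀ ρ, ∀ j ∈ univ.filter (fun j : Fin d → Fin n => (j ρ : ℕ) + 1 < n ∨ i ρ + 1 ≤ len ρ),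
      ‖(sdiff (fine n M) (n : ℂ) ρ *ᵥ μt) (csiteB n M lo i j)‖ ^ 2 = ‖R (csiteB n M lo i j, ρ)‖ ^ 2 := by
    intro i hi ρ j hj
    rw [hR]
    simp only
    rw [ext_apply_of_not _ _ (not_starReg_internal n M lo len S hKS hi j ρ (mem_filter.1 hj).2), zero_sub, norm_neg,
      GradOp_mulVec]
  rw [sum_comm]
  refine sum_le_sum fun ρ _ => ?_
  calc ∑ i ∈ KIn len, GK n M lo len μt i ρ
      = ∑ i ∈ KIn len, ∑ j ∈ univ.filter (fun j : Fin d → Fin n => (j ρ : ℕ) + 1 < n ∨ i ρ + 1 ≤ len ρ), ‖R (csiteB n M lo i j, ρ)‖ ^ 2 :=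
        sum_congr rfl fun i hi => by rw [GK, sum_congr rfl (hterm i hi ρ)]
    _ ≤ ∑ i ∈ KIn len, ∑ j, ‖R (csiteB n M lo i j, ρ)‖ ^ 2 :=
        sum_le_sum fun i _ => sum_le_sum_of_subset_of_nonneg (subset_univ _) fun _ _ _ => by positivity
    _ = ∑ ij ∈ KIn len ×ˢ (univ : Finset (Fin d → Fin n)), ‖R (csiteB n M lo ij.1 ij.2, ρ)‖ ^ 2 := by
        rw [Finset.sum_product' (f := fun i j => ‖R (csiteB n M lo i j, ρ)‖ ^ 2)]
    _ = ∑ x ∈ boxSites n M lo len, ‖R (x, ρ)‖ ^ 2 := by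
        rw [boxSites, Finset.sum_image]
        exact fun a ha b hb h => csiteB_injOn n M lo len hM2
          (Finset.mem_coe.2 (Finset.mem_product.2 ⟨KIn_subset_KOff len (Finset.mem_product.1 ha).1, mem_univ _⟩))
          (Finset.mem_coe.2 (Finset.mem_product.2 ⟨KIn_subset_KOff len (Finset.mem_product.1 hb).1, mem_univ _⟩)) h

/-- hence, for one box, `Σ_{i ∈ KIn} Σ_ρ GK_{i,ρ} μ̃ ≤ nsq (ext A − ∂μ̃)`. [folklore] -/
theorem sum_GK_le_residual (hKS : ∀ y ∈ boxBlocks M lo len, ¬ S y) (hM2 : ∀ μ, len μ + 2 ≤ M μ) (A : {b // starReg n M S b} → ℂ)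
    (μt : Tor (fine n M) → ℂ) :
    ∑ i ∈ KIn len, ∑ ρ, GK n M lo len μt i ρ ≤ nsq (fun b => ext (starReg n M S) A b - (GradOp (fine n M) (n : ℂ) *ᵥ μt) b) := by
  refine (sum_GK_le_boxSum n M lo len S hKS hM2 A μt).trans ?_
  calc ∑ ρ : Fin d, ∑ x ∈ boxSites n M lo len, ‖ext (starReg n M S) A (x, ρ) - (GradOp (fine n M) (n : ℂ) *ᵥ μt) (x, ρ)‖ ^ 2
      ≤ ∑ ρ : Fin d, ∑ x : Tor (fine n M), ‖ext (starReg n M S) A (x, ρ) - (GradOp (fine n M) (n : ℂ) *ᵥ μt) (x, ρ)‖ ^ 2 :=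
        sum_le_sum fun ρ _ => sum_le_sum_of_subset_of_nonneg (subset_univ _) fun _ _ _ => by positivity
    _ = _ := by unfold nsq; rw [Fintype.sum_prod_type_right]

end AnyRegion

/-- **THE MASS OF `μ̃` ON EACH BLOCK OF THE BOX IS RESIDUAL ENERGY** (blockwise Poincaré with zero block means):
`Σ_{i ∈ KIn} mass_i μ̃ ≤ Σ_{i ∈ KIn} Σ_ρ GK_{i,ρ} μ̃`. [folklore] -/
theorem sum_massK_le (μt : Tor (fine n M) → ℂ) (hQ : ∀ y, (QsOp n M *ᵥ μt) y = 0) :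
    ∑ i ∈ KIn len, massK n M lo μt i ≤ ∑ i ∈ KIn len, ∑ ρ, GK n M lo len μt i ρ := by
  refine sum_le_sum fun i _ => ?_
  have h := sum_block_norm_sub_mean_sq_le n M μt (cblkB M lo i)
  simp only [hQ, sub_zero] at h
  have hc : ((n : ℝ) - 1) / (2 * n) ≤ 1 := by
    have hn : (1 : ℝ) ≤ n := by exact_mod_cast Nat.pos_of_ne_zero (NeZero.ne n)
    rw [div_le_one (by positivity)]; linarith
  have hW : 0 ≤ ∑ ν : Fin d, ∑ j ∈ univ.filter (fun j : Fin d → Fin n => (j ν : ℕ) + 1 < n),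
      ‖(sdiff (fine n M) (n : ℂ) ν *ᵥ μt) (bpt n M (cblkB M lo i) j)‖ ^ 2 := sum_nonneg fun _ _ => sum_nonneg fun _ _ => by positivity
  calc massK n M lo μt i = ∑ j : Fin d → Fin n, ‖μt (bpt n M (cblkB M lo i) j)‖ ^ 2 := rfl
    _ ≤ ((n : ℝ) - 1) / (2 * n) * ∑ ν : Fin d, ∑ j ∈ univ.filter (fun j : Fin d → Fin n => (j ν : ℕ) + 1 < n),
          ‖(sdiff (fine n M) (n : ℂ) ν *ᵥ μt) (bpt n M (cblkB M lo i) j)‖ ^ 2 := h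
    _ ≤ 1 * ∑ ν : Fin d, ∑ j ∈ univ.filter (fun j : Fin d → Fin n => (j ν : ℕ) + 1 < n),
          ‖(sdiff (fine n M) (n : ℂ) ν *ᵥ μt) (bpt n M (cblkB M lo i) j)‖ ^ 2 := mul_le_mul_of_nonneg_right hc hW
    _ ≤ ∑ ρ, GK n M lo len μt i ρ := by
        rw [one_mul]
        refine sum_le_sum fun ρ _ => ?_
        rw [GK]
        exact sum_le_sum_of_subset_of_nonneg (fun j hj => mem_filter.2 ⟨mem_univ _, Or.inl (mem_filter.1 hj).2⟩)
          fun _ _ _ => by positivity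

/-! ## §2 The gauge–Poincaré inequality and W1 on the complement of a box -/

/-- **THE GAUGE–POINCARÉ INEQUALITY ON `T ∖ K`** (`1 ≤ len_ν`, `len_ν + 2 ≤ M_ν`, `1 ≤ n`, `0 < a`, `0 < a′`), constants `K/γ_D`, `K a/γ_D`,
`K = 2 + 4(d+1)3^d` — the same as for one hole. [folklore] -/
theorem gaugePoincare_boxHole (hlen : ∀ ν, 1 ≤ len ν) (hM2 : ∀ μ, len μ + 2 ≤ M μ) (hn : 1 ≤ n) (ha : 0 < a) (ha' : 0 < a')
    (A : {b // starReg n M (fun y : Tor M => y ∉ boxBlocks M lo len) b} → ℂ) :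
    ∃ μ : {x // blockReg n M (fun y : Tor M => y ∉ boxBlocks M lo len) x} → ℂ,
      nsq (A - gradR n M (fun y : Tor M => y ∉ boxBlocks M lo len) *ᵥ μ) ≤ Kholed d / gamD d a * nsq (curlR n M (fun y : Tor M => y ∉ boxBlocks M lo len) *ᵥ A)
        + Kholed d * a / gamD d a * ((n : ℝ) ^ d * nsq (avgR n M (fun y : Tor M => y ∉ boxBlocks M lo len) *ᵥ A)) := by
  classical
  obtain ⟨μt, hQ, hμt⟩ := exists_torus_gauge n M a a' (fun y : Tor M => y ∉ boxBlocks M lo len) hn ha ha' A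
  set R : Tor (fine n M) × Fin d → ℂ := fun b => ext (starReg n M (fun y : Tor M => y ∉ boxBlocks M lo len)) A b - (GradOp (fine n M) (n : ℂ) *ᵥ μt) b with hR
  set lam := liftB n M lo len μt with hlam
  refine ⟨fun x => μt x.1 - lam x.1, ?_⟩
  have hext : ext (blockReg n M (fun y : Tor M => y ∉ boxBlocks M lo len)) (fun x : {x // blockReg n M (fun y : Tor M => y ∉ boxBlocks M lo len) x} => μt x.1 - lam x.1) = μt - lam := by
    funext x
    by_cases hx : blockReg n M (fun y : Tor M => y ∉ boxBlocks M lo len) x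
    · exact ext_apply_of (blockReg n M (fun y : Tor M => y ∉ boxBlocks M lo len)) _ ⟨x, hx⟩
    · rw [ext_apply_of_not _ _ hx, Pi.sub_apply]
      rw [hlam, liftB_of_inside n M lo len μt ((not_blockReg_iff n M lo len hM2 x).1 hx), sub_self]
  have hres : ext (starReg n M (fun y : Tor M => y ∉ boxBlocks M lo len)) (A - gradR n M (fun y : Tor M => y ∉ boxBlocks M lo len) *ᵥ fun x => μt x.1 - lam x.1)
      = fun b => if starReg n M (fun y : Tor M => y ∉ boxBlocks M lo len) b then R b + (GradOp (fine n M) (n : ℂ) *ᵥ lam) b else 0 := by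
    funext b
    by_cases hb : starReg n M (fun y : Tor M => y ∉ boxBlocks M lo len) b
    · rw [if_pos hb, ext_apply_of (starReg n M (fun y : Tor M => y ∉ boxBlocks M lo len)) _ ⟨b, hb⟩, Pi.sub_apply, gradR, toBlock_mulVec', hext, hR]
      simp only
      rw [Matrix.mulVec_sub, Pi.sub_apply, ext_apply_of (starReg n M (fun y : Tor M => y ∉ boxBlocks M lo len)) A ⟨b, hb⟩]
      ring
    · rw [if_neg hb, ext_apply_of_not _ _ hb]
  have hgrad : nsq (GradOp (fine n M) (n : ℂ) *ᵥ lam) ≤ (2 * 3 ^ d + 2 * d * 3 ^ d) * nsq R := by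
    have h1 := nsq_grad_liftB_le n M lo len hlen hM2 μt
    have h2 := sum_GK_le_residual n M lo len (fun y : Tor M => y ∉ boxBlocks M lo len) (fun y hy hS => hS hy) hM2 A μt
    have h3 := (sum_massK_le n M lo len μt hQ).trans h2
    have h33 : (0 : ℝ) ≤ 2 * d * 3 ^ d := by positivity
    have h22 : (0 : ℝ) ≤ 2 * 3 ^ d := by positivity
    calc nsq (GradOp (fine n M) (n : ℂ) *ᵥ lam)
        ≤ 2 * 3 ^ d * ∑ i ∈ KIn len, ∑ ρ, GK n M lo len μt i ρ + 2 * d * 3 ^ d * ∑ i ∈ KIn len, massK n M lo μt i := h1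
      _ ≤ 2 * 3 ^ d * nsq R + 2 * d * 3 ^ d * nsq R := add_le_add (mul_le_mul_of_nonneg_left h2 h22) (mul_le_mul_of_nonneg_left h3 h33)
      _ = _ := by ring
  have hsum : nsq (A - gradR n M (fun y : Tor M => y ∉ boxBlocks M lo len) *ᵥ fun x => μt x.1 - lam x.1) ≤ 2 * nsq R + 2 * nsq (GradOp (fine n M) (n : ℂ) *ᵥ lam) := by
    rw [← nsq_ext (starReg n M (fun y : Tor M => y ∉ boxBlocks M lo len)), hres]
    unfold nsq
    rw [mul_sum, mul_sum, ← sum_add_distrib]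
    refine sum_le_sum fun b _ => ?_
    dsimp only
    split_ifs
    · have := norm_add_le (R b) ((GradOp (fine n M) (n : ℂ) *ᵥ lam) b)
      nlinarith [norm_nonneg (R b + (GradOp (fine n M) (n : ℂ) *ᵥ lam) b), norm_nonneg (R b),
        norm_nonneg ((GradOp (fine n M) (n : ℂ) *ᵥ lam) b), sq_nonneg (‖R b‖ - ‖(GradOp (fine n M) (n : ℂ) *ᵥ lam) b‖)]
    · rw [norm_zero]
      nlinarith [norm_nonneg (R b), norm_nonneg ((GradOp (fine n M) (n : ℂ) *ᵥ lam) b)]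
  have hγ := gamD_pos (d := d) a
  have hRle : nsq R ≤ (nsq (curlR n M (fun y : Tor M => y ∉ boxBlocks M lo len) *ᵥ A) + a * (n : ℝ) ^ d * nsq (avgR n M (fun y : Tor M => y ∉ boxBlocks M lo len) *ᵥ A)) / gamD d a := by
    rw [le_div_iff₀ hγ, mul_comm]; exact hμt
  have hK : nsq (A - gradR n M (fun y : Tor M => y ∉ boxBlocks M lo len) *ᵥ fun x => μt x.1 - lam x.1) ≤ Kholed d * nsq R := by
    calc nsq (A - gradR n M (fun y : Tor M => y ∉ boxBlocks M lo len) *ᵥ fun x => μt x.1 - lam x.1)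
        ≤ 2 * nsq R + 2 * ((2 * 3 ^ d + 2 * d * 3 ^ d) * nsq R) := by linarith [hsum, hgrad]
      _ = Kholed d * nsq R := by rw [Kholed]; ring
  have hKpos : 0 ≤ Kholed d := by unfold Kholed; positivity
  calc nsq (A - gradR n M (fun y : Tor M => y ∉ boxBlocks M lo len) *ᵥ fun x => μt x.1 - lam x.1) ≤ Kholed d * nsq R := hK
    _ ≤ Kholed d * ((nsq (curlR n M (fun y : Tor M => y ∉ boxBlocks M lo len) *ᵥ A) + a * (n : ℝ) ^ d * nsq (avgR n M (fun y : Tor M => y ∉ boxBlocks M lo len) *ᵥ A)) / gamD d a) :=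
        mul_le_mul_of_nonneg_left hRle hKpos
    _ = _ := by simp only [div_eq_mul_inv]; ring

/-- **W1 IN ORBIT FORM ON `T ∖ K`, EVERY LEVEL `n ≥ 1`**. [folklore] -/
theorem orthSlice_boxHole (hlen : ∀ ν, 1 ≤ len ν) (hM2 : ∀ μ, len μ + 2 ≤ M μ) (ha : 0 < a) (ha' : 0 < a') :
    OrthSliceCoercive (curlR n M (fun y : Tor M => y ∉ boxBlocks M lo len)) (gradR n M (fun y : Tor M => y ∉ boxBlocks M lo len)) (QOm n M (fun y : Tor M => y ∉ boxBlocks M lo len)) (avgR n M (fun y : Tor M => y ∉ boxBlocks M lo len)) (a * (n : ℝ) ^ d)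
      (orbitConst d a (Kholed d / gamD d a) (Kholed d * a / gamD d a)) := by
  by_cases hn : 2 ≤ n
  · exact orthSlice_of_gaugePoincare n M a (fun y : Tor M => y ∉ boxBlocks M lo len) hn ha (KC₂_nonneg a ha)
      (gaugePoincare_boxHole n M lo len a a' hlen hM2 (by omega) ha ha')
  · obtain rfl : n = 1 := by have := NeZero.ne n; omega
    exact orthSlice_one M (fun y : Tor M => y ∉ boxBlocks M lo len) a (orbitConst_le ha (KC₂_nonneg a ha))

/-- **THE DISPLAYED W1 INEQUALITY ON THE COMPLEMENT OF A BOX OF BLOCKS — ONE LEVEL-UNIFORM CONSTANT** `holedConst d a a′` (free of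
`n`, `M`, the box): for `S = (· ∉ boxBlocks M lo len)`, `1 ≤ len_ν`, `len_ν + 2 ≤ M_ν`, every level `n ≥ 1`, `0 < a`, `0 < a′`. [folklore] -/
theorem sliceCoercive_boxHole (hlen : ∀ ν, 1 ≤ len ν) (hM2 : ∀ μ, len μ + 2 ≤ M μ) (ha : 0 < a) (ha' : 0 < a') :
    SliceCoercive (curlR n M (fun y : Tor M => y ∉ boxBlocks M lo len)) (gradR n M (fun y : Tor M => y ∉ boxBlocks M lo len)) (GOm n M a' (fun y : Tor M => y ∉ boxBlocks M lo len)) (QOm n M (fun y : Tor M => y ∉ boxBlocks M lo len)) (avgR n M (fun y : Tor M => y ∉ boxBlocks M lo len)) (a * (n : ℝ) ^ d) (holedConst d a a') :=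
  sliceCoercive_region_of_orthSlice n M a a' (fun y : Tor M => y ∉ boxBlocks M lo len) ha' (orbitConst_pos d ha (KC₂_nonneg a ha)).le
    (orthSlice_boxHole n M lo len a a' hlen hM2 ha ha')

/-- coercivity of `Δ_a(Ω₀)` on `T ∖ K`, uniformly in the level. [folklore] -/
theorem coercive_regionDeltaA_boxHole (hlen : ∀ ν, 1 ≤ len ν) (hM2 : ∀ μ, len μ + 2 ≤ M μ) (ha : 0 < a) (ha' : 0 < a') :
    Coercive (regionDeltaA n M a a' (fun y : Tor M => y ∉ boxBlocks M lo len))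
      (min (orbitConst d a (Kholed d / gamD d a) (Kholed d * a / gamD d a) / (1 + 4 * d / sigma0 d a') / 2)
        (1 / (2 * (gammaPs d a')⁻¹))) :=
  coercive_regionDeltaA_of_orthSlice n M a a' (fun y : Tor M => y ∉ boxBlocks M lo len) ha' (orbitConst_pos d ha (KC₂_nonneg a ha)) (orthSlice_boxHole n M lo len a a' hlen hM2 ha ha')

/-- «`G(Ω₀)` exists with a level-uniform bound» on `T ∖ K`. [folklore] -/
theorem opNorm_inv_regionDeltaA_boxHole_le (hlen : ∀ ν, 1 ≤ len ν) (hM2 : ∀ μ, len μ + 2 ≤ M μ) (ha : 0 < a) (ha' : 0 < a') :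
    ‖(regionDeltaA n M a a' (fun y : Tor M => y ∉ boxBlocks M lo len))⁻¹‖
      ≤ (min (orbitConst d a (Kholed d / gamD d a) (Kholed d * a / gamD d a) / (1 + 4 * d / sigma0 d a') / 2)
          (1 / (2 * (gammaPs d a')⁻¹)))⁻¹ :=
  opNorm_inv_regionDeltaA_le_of_orthSlice n M a a' (fun y : Tor M => y ∉ boxBlocks M lo len) ha' (orbitConst_pos d ha (KC₂_nonneg a ha))
    (orthSlice_boxHole n M lo len a a' hlen hM2 ha ha')

/-- **THE STAR-TOWER W1 SOCKET DISCHARGED ON `T ∖ K`**: `∀ k, SliceCoercive (… lev L k …) (holedConst d a a′)`. [folklore] -/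
theorem sliceCoercive_lev_boxHole (L : ℕ) [NeZero L] (hlen : ∀ ν, 1 ≤ len ν) (hM2 : ∀ μ, len μ + 2 ≤ M μ) (ha : 0 < a) (ha' : 0 < a')
    (k : ℕ) :
    SliceCoercive (curlR (lev L k) M (fun y : Tor M => y ∉ boxBlocks M lo len)) (gradR (lev L k) M (fun y : Tor M => y ∉ boxBlocks M lo len)) (GOm (lev L k) M a' (fun y : Tor M => y ∉ boxBlocks M lo len)) (QOm (lev L k) M (fun y : Tor M => y ∉ boxBlocks M lo len)) (avgR (lev L k) M (fun y : Tor M => y ∉ boxBlocks M lo len))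
      (a * ((lev L k : ℕ) : ℝ) ^ d) (holedConst d a a') :=
  sliceCoercive_boxHole (lev L k) M lo len a a' hlen hM2 ha ha'

end Summit.QuantumFields.BalabanUV.T4Continuum.RegionGaugeBoxHole

end
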